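import Mathlib.Analysis.SpecialFunctions.Complex.Arg
import Mathlib.MeasureTheory.Measure.WithDensity
import Literature.Probability.LatticeModels.LatticeInterface
import HarnessLib

/-!
# The tilted harmonic explorer on the triangular lattice: the law of its hexagon colouring

Definition file (request `defn-tiltedExplorerMeasure`, route CriticalPhenomena/SAWScalingLimit/
SAWTiltedExplorer, card `tilted-harmonic-explorer`; consumers: the route items
`TiltedExplorerMartingale`, `KineticTwinHex`, `TiltedExplorerRegular`, stmt-CriticalPhenomena-8291).

## The object

Schramm–Sheffield's **harmonic explorer** (Ann. Probab. 33 (2005) = arXiv:math/0310210, §2,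
"Definition of HE", pp. 5–6 of the arXiv text): the hexagonal exploration interface of a
Dobrushin domain of `δ𝕋` (hexagons = sites of `𝕋`; arc `A` open/black on the LEFT of the path,
arc `B` closed/white on the right — the tree's convention of
`Literature.Probability.LatticeModels.IsExplorationStep`) is generated dynamically; at the tip
triangle `T_{n+1}` the vertex `v_{n+1}` "which is not on the edge containing `η_n`" (the hexagon
AHEAD) is examined; if its colour is already determined (arc hexagon, or coloured earlier) the step
is forced; otherwise it is coloured black with probability `p_{n+1}` = "the value at `v_{n+1}` of
the discrete harmonic extension of `h_n`", the current boundary data (`1` on black, `0` on white),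
"discrete harmonic at the undetermined faces (i.e., its value at each such face is the mean of the
values on the six neighboring faces)"; then `h_{n+1}(v_{n+1}) := 1_{X_{n+1} ≤ p_{n+1}}` is frozen.

The **tilted** explorer of the route (parameters: arc data `β : Site 2 → ℝ`, tilt `c`, gap `g`)
replaces the data `{0, 1}` by ANGLE-DEPENDENT bank values frozen at colouring time: with `A_t` the
unwrapped absolute angle of the dart entering the tip face at step `t` (consecutive darts of the
honeycomb path differ by `±π/3`; the branch of the first dart's angle is the representative of
`arg` closest to `π (β x_a + β y_b)/2 + π/2`, `{x_a, y_b}` the two hexagons of the first crossed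
edge), put `f_R(t) := g + c (A_t + π/3 - π/2)/(π/3)` and `f_L(t) := -g + c (A_t - π/3 - π/2)/(π/3)`;
the data are `β` on the two arcs and, for a hexagon coloured at the free step `s`, the frozen value
`f_L(s)` if it was coloured open/`A` (it lies on the LEFT bank; the path turned right) and `f_R(s)`
if closed/`B` (right bank; the path turned left). The coin: the examined hexagon `v` is coloured
OPEN with probability `p_t := clamp_{[0,1]} ((f_R(t) - H_t(v)) / (f_R(t) - f_L(t)))`, `H_t(v)` the
value at `v` of the discrete harmonic extension of the current data (six-neighbour means along the
edges of the discrete domain graph `Ω_δ`, i.e. simple random walk on `𝕋` with weight `(1/6)^length`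
using only edges of `triDiscreteDomainGraph`, absorbed at the first determined hexagon), so that
`E[value of v | past] = p_t f_L + (1 - p_t) f_R = H_t(v)` whenever unclamped. For `c = 0`
(any `g > 0`, with `β = -g` on the arc `A` and `β = +g` on the arc `B`) the bank values are the
constants `∓g` and `p_t = (g - H_t(v))/(2g)` is exactly Schramm–Sheffield's coin (the harmonic
measure of `A ∪ {open hexagons}` seen from `v`; affinely their `{0,1}` data, `p = h_n(v)` =
probability of black = open): the harmonic explorer.

## The definition (law of the full colouring, as a density against fair site percolation)

Given a FULL configuration `ω`, the exploration interface `explorationWalk E ω` (a walk on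
`hexGraph`, `LatticeInterface.lean`) is deterministic, and so are, along its darts
`d_t : f_{t-1} → f_t`: the examined hexagon `v_t = aheadVertex f_{t-1} f_t` (the vertex of `f_t`
off the crossed edge), whether step `t` is FREE (`v_t ∈ Ω_δ`, off both arcs, not examined at an
earlier free step), the angles `A_t` (`A_{t+1} = A_t - π/3` if `v_t` is open/`A` under the boundary
condition — the path turns right —, `+ π/3` otherwise), the frozen values, `H_t`, `p_t`. The
sequential description (colour `v_t` by the `p_t`-coin at free steps; fair coins for the hexagons
never examined) is therefore the measure

  `tiltedExplorerMeasure E β c g := (triSitePercolation 1/2).withDensity ρ`,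
  `ρ(ω) := ∏_{t free} (2 p_t(ω))^{[v_t ∈ ω]} (2 (1 - p_t(ω)))^{[v_t ∉ ω]}`

(likelihood ratio of the `p_t`-coins against fair coins on the examined hexagons; computed by a
left fold of `tiltedExplorerStep` over the darts, `tiltedExplorerDensity`). Junk values (documented
at each definition): no (unique) exploration path ⇒ `ρ = 1` (fair percolation); non-unique
Dirichlet problem (unbounded `Ω`) ⇒ the harmonic extension falls back to the raw data;
`f_R = f_L` (`c + g = 0`) ⇒ `p = 0` by `x / 0 = 0`; the last (outer) face's ahead-vertex lies
outside `Ω_δ` and is never free. Measurability of `ρ` (finite range for bounded `Ω`, `δ > 0`) and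
`ρ`'s total mass `1` (the tower property of the coins) are the route's items (iii), (i) and are NOT
proved here; `Measure.withDensity` is a measure for any `ρ`.

## Contents

* `triSubgraphMean`, `IsTriHarmonicExtension`, `triHarmonicExtension` — six-neighbour discrete
  harmonic extension along a subgraph of `𝕋` (Schramm–Sheffield §2);
* `aheadVertex`, `TiltedExplorerState`, `tiltedExplorerInitAngle`, `tiltedExplorerStep`,
  `tiltedExplorerRun`, `tiltedExplorerDensity`, `tiltedExplorerMeasure`;
* API: `tiltedExplorerStep_density_nonneg`, `tiltedExplorerDensity_nonneg`,
  `tiltedExplorerDensity_of_explorationWalk_eq_none`, `tiltedExplorerMeasure_apply`.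

## References

* O. Schramm, S. Sheffield, *Harmonic explorer and its convergence to SLE₄*, Ann. Probab. 33
  (2005) 2127–2148 = arXiv:math/0310210, §2 (definition of HE; Lemma 2.1, the martingale
  property). [SchrammSheffield2005]
* J. Miller, S. Sheffield, *Imaginary geometry I*, arXiv:1201.1496, Thm. 1.1 (flow-line
  constants behind the tilt `c = (π/3) χ/λ'`). [MillerSheffield2016]
* S. Smirnov, C. R. Acad. Sci. 333 (2001), §2 (hexagonal exploration). [Smirnov2001]
-/

noncomputable section

open MeasureTheory Finset
open scoped ENNReal

namespace Literature.Probability.RandomPlanarGeometry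

open Literature.Probability.LatticeModels Literature.Probability.Percolation

/-! ### Six-neighbour discrete harmonic extension along a subgraph of `𝕋` -/

open scoped Classical in
/-- The six-neighbour mean of `H` at `w` along the subgraph `G ≤ 𝕋`:
`(1/6) ∑_{w' ∼_𝕋 w, G.Adj w w'} H w'` — one step of the simple random walk on `𝕋` (each of the
six neighbours with probability `1/6`) using only edges of `G` (killed otherwise). For `G = Ω_δ`
and `w` an interior undetermined hexagon all six edges are present and this is the plain mean
"of the values on the six neighboring faces". [cite: SchrammSheffield2005, §2 (definition of HE)] -/
def triSubgraphMean (G : SimpleGraph (Site 2)) (H : Site 2 → ℝ) (w : Site 2) : ℝ :=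
  (1 / 6 : ℝ) * ∑ w' ∈ triGraph.neighborFinset w, if G.Adj w w' then H w' else 0

/-- `H` is *the discrete harmonic extension of `data` off `U` along `G`*: `H = data` outside the
undetermined set `U` and `H` equals its six-neighbour `G`-mean at every site of `U`
("discrete harmonic at the undetermined faces"). [cite: SchrammSheffield2005, §2 (definition of HE)] -/
def IsTriHarmonicExtension (G : SimpleGraph (Site 2)) (U : Set (Site 2)) (data H : Site 2 → ℝ) :
    Prop :=
  (∀ w ∉ U, H w = data w) ∧ ∀ w ∈ U, H w = triSubgraphMean G H w

open scoped Classical in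
/-- **The discrete harmonic extension** of `data` to the undetermined set `U` along `G`: the
unique `H` with `IsTriHarmonicExtension G U data H` when it exists uniquely (always the case for
finite `U`, e.g. `U ⊆ Ω_δ` with `Ω` bounded: a finite subset of `𝕋` closed under the six
neighbour moves is empty, so the killed walk leaves `U` almost surely and the linear system is
uniquely solvable), and the documented junk value `data` otherwise. Its value at `v ∈ U` is
`∑_u hm(v, u) data(u)`, `hm` the exit distribution from `U` of the walk started at `v`.
[cite: SchrammSheffield2005, §2 (definition of HE: "the discrete harmonic extension")] -/
def triHarmonicExtension (G : SimpleGraph (Site 2)) (U : Set (Site 2)) (data : Site 2 → ℝ) :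
    Site 2 → ℝ :=
  if h : ∃! H : Site 2 → ℝ, IsTriHarmonicExtension G U data H then h.choose else data

/-- When the Dirichlet problem is uniquely solvable, `triHarmonicExtension` solves it. [cite: SchrammSheffield2005, §2 (definition of HE)] -/
theorem isTriHarmonicExtension_triHarmonicExtension {G : SimpleGraph (Site 2)} {U : Set (Site 2)}
    {data : Site 2 → ℝ} (h : ∃! H : Site 2 → ℝ, IsTriHarmonicExtension G U data H) :
    IsTriHarmonicExtension G U data (triHarmonicExtension G U data) := by
  classical
  rw [triHarmonicExtension, dif_pos h]
  exact h.choose_spec.1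

/-! ### Bookkeeping along the exploration path -/

open scoped Classical in
/-- The hexagon AHEAD when the path enters the face `g` from the adjacent face `f`: the vertex of
`g` which is not on the crossed edge `hexFaceVertices f ∩ hexFaceVertices g` (Schramm–Sheffield:
"the vertex of `T_{n+1}` which is not on the edge containing `η_n`"). Junk value `g.1` when `f`,
`g` are not adjacent faces. [cite: SchrammSheffield2005, §2 (definition of HE)] -/
def aheadVertex (f g : HexVertex) : Site 2 :=
  if h : ∃ v : Site 2, hexFaceVertices g \ hexFaceVertices f = {v} then h.choose else g.1

/-- The state of the tilted explorer after some steps: the unwrapped absolute angle of the NEXT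
dart to be processed (the dart entering the next tip face), the hexagons coloured at the free steps
so far together with their frozen bank values (most recent first), and the accumulated likelihood
ratio of the coins against fair coins. [cite: SchrammSheffield2005, §2 (definition of HE)] -/
structure TiltedExplorerState where
  /-- Unwrapped absolute angle `A_t` of the dart entering the current tip face. -/
  angle : ℝ
  /-- Hexagons coloured at free steps so far, with their frozen bank values (latest first). -/
  coloured : List (Site 2 × ℝ)
  /-- Accumulated density `∏ (2 p_s)^{[open]} (2 (1 - p_s))^{[closed]}` over the free steps so far. -/
  density : ℝ

/-- The anchored initial angle: for the first dart `f₀ → f₁` of the exploration path, the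
representative of `arg (hexCenter f₁ - hexCenter f₀)` modulo `2π` closest to the gauge target
`τ = π (∑_{u ∈ crossed edge} β u)/2 + π/2` (the crossed edge `{x_a, y_b}` is
`hexFaceVertices f₀ ∩ hexFaceVertices f₁`): `φ + 2π · round ((τ - φ)/(2π))`. (Route gauge
convention; the harmonic explorer itself, `c = 0`, does not see the angle.) [cite: SchrammSheffield2005, §2 (definition of HE)] -/
def tiltedExplorerInitAngle (β : Site 2 → ℝ) (f₀ f₁ : HexVertex) : ℝ :=
  let φ : ℝ := Complex.arg (hexCenter f₁ - hexCenter f₀)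
  let τ : ℝ := Real.pi * (∑ u ∈ hexFaceVertices f₀ ∩ hexFaceVertices f₁, β u) / 2 + Real.pi / 2
  φ + 2 * Real.pi * (round ((τ - φ) / (2 * Real.pi)) : ℝ)

/-- The right-bank value `f_R = g + c (A + π/3 - π/2)/(π/3)` at entering angle `A`. [cite: SchrammSheffield2005, §2 (definition of HE)] -/
def tiltedBankRight (c g A : ℝ) : ℝ := g + c * ((A + Real.pi / 3 - Real.pi / 2) / (Real.pi / 3))

/-- The left-bank value `f_L = -g + c (A - π/3 - π/2)/(π/3)` at entering angle `A`. [cite: SchrammSheffield2005, §2 (definition of HE)] -/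
def tiltedBankLeft (c g A : ℝ) : ℝ := -g + c * ((A - Real.pi / 3 - Real.pi / 2) / (Real.pi / 3))

/-- The clamped coin probability `p = clamp_{[0,1]} ((f_R - H)/(f_R - f_L))` (the affine solution
of `p f_L + (1 - p) f_R = H`; junk `0` when `f_R = f_L` by `x / 0 = 0`). [cite: SchrammSheffield2005, §2 (definition of HE)] -/
def tiltedCoin (fR fL H : ℝ) : ℝ := max 0 (min 1 ((fR - H) / (fR - fL)))

/-- `0 ≤ tiltedCoin fR fL H`. [cite: SchrammSheffield2005, §2 (definition of HE)] -/
theorem tiltedCoin_nonneg (fR fL H : ℝ) : 0 ≤ tiltedCoin fR fL H := le_max_left _ _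

/-- `tiltedCoin fR fL H ≤ 1`. [cite: SchrammSheffield2005, §2 (definition of HE)] -/
theorem tiltedCoin_le_one (fR fL H : ℝ) : tiltedCoin fR fL H ≤ 1 :=
  max_le zero_le_one (min_le_left _ _)

open scoped Classical in
/-- **One step of the tilted explorer** in the configuration `ω`, processing the dart `f → g`
(entering the tip face `g` at unwrapped angle `s.angle`): the hexagon ahead `v = aheadVertex f g`
is examined. The step is FREE iff `v ∈ Ω_δ`, `v` is on neither discrete arc and was not coloured
at an earlier free step; then the current data (`β` on the arcs, frozen values on the coloured
hexagons, `0` elsewhere — never read) are harmonically extended along `Ω_δ` to the undetermined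
hexagons, `H = ` its value at `v`, `p = tiltedCoin f_R f_L H`, and `v` receives the frozen value
`f_L` if it is open (left bank) / `f_R` if closed (right bank), the density being multiplied by
`2p` resp. `2(1 - p)`. In all cases the next angle is `A - π/3` if `v` is open-or-arc-`A` under the
boundary condition (`E.bcConfig ω`: the path turns RIGHT, keeping `v` on its left) and `A + π/3`
otherwise. [cite: SchrammSheffield2005, §2 (definition of HE)] -/
def tiltedExplorerStep (E : DiscreteDobrushin) (β : Site 2 → ℝ) (c g : ℝ)
    (ω : SiteConfig (Site 2)) (s : TiltedExplorerState) (d : HexVertex × HexVertex) :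
    TiltedExplorerState :=
  let v : Site 2 := aheadVertex d.1 d.2
  let turn : ℝ := if v ∈ E.bcConfig ω then -(Real.pi / 3) else Real.pi / 3
  let fR : ℝ := tiltedBankRight c g s.angle
  let fL : ℝ := tiltedBankLeft c g s.angle
  if v ∈ triMeshDomain E.Ω E.δ ∧ v ∉ E.triArcA ∧ v ∉ E.triArcB ∧ v ∉ s.coloured.map Prod.fst then
    let determined : Set (Site 2) := E.triArcA ∪ E.triArcB ∪ {w | w ∈ s.coloured.map Prod.fst}
    let data : Site 2 → ℝ := fun w =>
      if w ∈ E.triArcA ∪ E.triArcB then β w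
      else ((s.coloured.find? fun q => q.1 = w).map Prod.snd).getD 0
    let H : ℝ := triHarmonicExtension (triDiscreteDomainGraph E.Ω E.δ)
      (triMeshDomain E.Ω E.δ \ determined) data v
    let p : ℝ := tiltedCoin fR fL H
    { angle := s.angle + turn
      coloured := (v, if v ∈ ω then fL else fR) :: s.coloured
      density := s.density * (if v ∈ ω then 2 * p else 2 * (1 - p)) }
  else
    { s with angle := s.angle + turn }

/-- The full run of the tilted explorer along a list of darts (as pairs of faces), from the
anchored initial angle, no coloured hexagon and density `1`. [cite: SchrammSheffield2005, §2 (definition of HE)] -/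
def tiltedExplorerRun (E : DiscreteDobrushin) (β : Site 2 → ℝ) (c g : ℝ) (ω : SiteConfig (Site 2))
    (A₀ : ℝ) (darts : List (HexVertex × HexVertex)) : TiltedExplorerState :=
  darts.foldl (tiltedExplorerStep E β c g ω) ⟨A₀, [], 1⟩

/-- **The density of the tilted explorer's colouring against fair site percolation**:
`ρ(ω) = ∏_{t free} (2 p_t)^{[v_t ∈ ω]} (2 (1 - p_t))^{[v_t ∉ ω]}`, computed along the darts of the
exploration interface `explorationWalk E ω` of the full configuration `ω`; junk value `1` when
there is no (unique) exploration path. [cite: SchrammSheffield2005, §2 (definition of HE)] -/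
def tiltedExplorerDensity (E : DiscreteDobrushin) (β : Site 2 → ℝ) (c g : ℝ)
    (ω : SiteConfig (Site 2)) : ℝ :=
  match explorationWalk E ω with
  | none => 1
  | some γ =>
    match γ.2.2.darts.map (fun d => (d.fst, d.snd)) with
    | [] => 1
    | (f₀, f₁) :: rest =>
      (tiltedExplorerRun E β c g ω (tiltedExplorerInitAngle β f₀ f₁) ((f₀, f₁) :: rest)).density

/-- **The law of the hexagon colouring produced by the tilted harmonic explorer** with arc data
`β`, tilt `c` and gap `g` in the discrete Dobrushin domain `E`: fair site percolation on `𝕋`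
reweighted by `tiltedExplorerDensity` (the examined hexagons carry their `p_t`-coins, all other
hexagons independent fair coins), so that `explorationWalk E ω` under this measure is the explorer
path. For `c = 0` (and `β = ∓g` on the arcs `A`/`B`) the coins are Schramm–Sheffield's
harmonic-measure coins (harmonic explorer).
It is a probability measure for admissible `E` (tower property of the coins) — not proved here.
[cite: SchrammSheffield2005, §2 (definition of HE)] -/
def tiltedExplorerMeasure (E : DiscreteDobrushin) (β : Site 2 → ℝ) (c g : ℝ) :
    Measure (SiteConfig (Site 2)) :=
  (triSitePercolation half).withDensity fun ω => ENNReal.ofReal (tiltedExplorerDensity E β c g ω)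

/-! ### API -/

/-- `tiltedExplorerMeasure` on a measurable set, unfolded (`withDensity_apply`). [cite: SchrammSheffield2005, §2 (definition of HE)] -/
theorem tiltedExplorerMeasure_apply (E : DiscreteDobrushin) (β : Site 2 → ℝ) (c g : ℝ)
    {s : Set (SiteConfig (Site 2))} (hs : MeasurableSet s) :
    tiltedExplorerMeasure E β c g s =
      ∫⁻ ω in s, ENNReal.ofReal (tiltedExplorerDensity E β c g ω) ∂(triSitePercolation half) := by
  rw [tiltedExplorerMeasure, withDensity_apply _ hs]

/-- Without a (unique) exploration path the density is the junk value `1`. [cite: SchrammSheffield2005, §2 (definition of HE)] -/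
theorem tiltedExplorerDensity_of_explorationWalk_eq_none {E : DiscreteDobrushin} {β : Site 2 → ℝ}
    {c g : ℝ} {ω : SiteConfig (Site 2)} (h : explorationWalk E ω = none) :
    tiltedExplorerDensity E β c g ω = 1 := by
  simp [tiltedExplorerDensity, h]

/-- One step does not change the sign of the density: each coin factor `2p`, `2(1 - p)` is
non-negative since `p ∈ [0, 1]`. [cite: SchrammSheffield2005, §2 (definition of HE)] -/
theorem tiltedExplorerStep_density_nonneg (E : DiscreteDobrushin) (β : Site 2 → ℝ) (c g : ℝ)
    (ω : SiteConfig (Site 2)) {s : TiltedExplorerState} (hs : 0 ≤ s.density)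
    (d : HexVertex × HexVertex) : 0 ≤ (tiltedExplorerStep E β c g ω s d).density := by
  classical
  unfold tiltedExplorerStep
  simp only
  split_ifs <;> dsimp only <;>
    first
    | exact hs
    | exact mul_nonneg hs (mul_nonneg zero_le_two (tiltedCoin_nonneg _ _ _))
    | exact mul_nonneg hs (mul_nonneg zero_le_two (sub_nonneg.2 (tiltedCoin_le_one _ _ _)))

/-- The run keeps the density non-negative. [cite: SchrammSheffield2005, §2 (definition of HE)] -/
theorem tiltedExplorerRun_density_nonneg (E : DiscreteDobrushin) (β : Site 2 → ℝ) (c g : ℝ)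
    (ω : SiteConfig (Site 2)) (A₀ : ℝ) (darts : List (HexVertex × HexVertex)) :
    0 ≤ (tiltedExplorerRun E β c g ω A₀ darts).density := by
  unfold tiltedExplorerRun
  suffices h : ∀ (l : List (HexVertex × HexVertex)) (s : TiltedExplorerState), 0 ≤ s.density →
      0 ≤ (l.foldl (tiltedExplorerStep E β c g ω) s).density from h darts _ zero_le_one
  intro l
  induction l with
  | nil => intro s hs; simpa using hs
  | cons d l ih =>
    intro s hs
    rw [List.foldl_cons]
    exact ih _ (tiltedExplorerStep_density_nonneg E β c g ω hs d)

/-- **The density is non-negative.** [cite: SchrammSheffield2005, §2 (definition of HE)] -/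
theorem tiltedExplorerDensity_nonneg (E : DiscreteDobrushin) (β : Site 2 → ℝ) (c g : ℝ)
    (ω : SiteConfig (Site 2)) : 0 ≤ tiltedExplorerDensity E β c g ω := by
  unfold tiltedExplorerDensity
  split
  · exact zero_le_one
  · split
    · exact zero_le_one
    · exact tiltedExplorerRun_density_nonneg E β c g ω _ _

end Literature.Probability.RandomPlanarGeometry

end
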